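import Mathlib
import Literature.AlgebraicGeometry.Resolution.WeightedQuasiRegularIndexed
import HarnessLib

/-!
# The weighted-order chart law at the origin of the `c_j`-chart of a point blow-up — ARBITRARY dimension, ARBITRARY pivot

Topic: `Literature/AlgebraicGeometry/Resolution`. Dimension-general (and pivot-general) form of `WeightedOrderChartLawGeneral.lean`
(`c : Fin 3 → R`, pivot `c₁ = u₁`): fifth brick of the generalisation `Fin 3 → Fin (r+2)` of the tree's expansion-free rendering of
Hironaka's characteristic polyhedra (memo `run/shared/lean/pub/res-hironaka/L/res-L1-w42-stub-3/KEYCLAIM-PORT-PLAN.md` §4). Setting: a ring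
homomorphism `φ : R → R′` of regular local rings of the same dimension `n + 1`, regular systems of parameters `c` of `R` and `c′` of `R′`,
and a PIVOT index `j` with `c′_j = φ c_j` and `φ c_i = φ c_j · c′_i` for `i ≠ j` — the origin of the `c_j`-chart of the blowing up of the
closed point (CJS Lemma 12.1 / Setup B of Ch. 9: `y′ = y/u₁`, `u₂′ = u₂/u₁` is the pivot `j = u₁`; Lemma 12.2: `z′ = y/u₂`, `u₁′ = u₁/u₂` is the
pivot `j = u₂` — ONE statement for both charts, so that no `u₁ ↔ u₂` symmetry file is needed in general dimension). For positive weights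
`W′` at `R′` the pulled-back weight is `W_i = W′_i + W′_j` (`i ≠ j`), `W_j = W′_j`. PROVED:

* `pullbackWeightAt`, `chartExpAt` (`e ↦ e` with the `j`-th exponent replaced by the total degree `|e|`), `weight_chartExpAt`,
  `map_cmonom_chartAt` (`φ(c^e) = c′^{chartExpAt j e}`), `map_weightedOrderIdeal_le_chartAt` — `φ(F^{W}_ρ) ⊆ F′^{W′}_ρ`;
* `mem_weightedOrderIdeal_of_map_mem_chartAt` — **contraction** `F′^{W′}_ρ ∩ R ⊆ F^{W}_ρ` (weighted quasi-regularity of `R′`,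
  `coeff_mem_maximalIdeal_of_weval_mem_weightedOrderIdeal`);
* `le_weightedOrderIdeal_of_weakTransform_le_chartAt` — the law for weak transforms: `J ⊆ 𝔪^μ` and `(J R′ : (φ c_j)^μ) ⊆ F′^{W′}_{ρ′}` imply
  `J ⊆ F^{W}_{ρ′ + μ W′_j}` (Hironaka's vertex maps `(a₁, a₂) ↦ (a₁ + a₂ − 1, a₂)` / `(a₁, a₁ + a₂ − 1)` of CJS Lemma 12.1 (3) / 12.2 (3)
  in expansion-free form).

Sources: V. Cossart, U. Jannsen, S. Saito, LNM **2270** (2020), Ch. 9 Setup B, Lemma 9.2, Lemma 12.1, Lemma 12.2 [`CossartJannsenSaito2020`];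
V. Cossart, O. Piltant, J. Algebra 320 (2008), proof of Lemma 4.5, p. 12 [`CossartPiltant2008`]; H. Hironaka, J. Math. Kyoto Univ. 7
(1967), §1 [`Hironaka1967`]. Statements and proofs follow the `Fin 3` file verbatim. No named facts; no instance, notation or attribute.
-/

noncomputable section

open IsLocalRing MvPolynomial

namespace Literature.AlgebraicGeometry.Resolution

namespace WeightedOrder

universe u

section Chart

variable {R R' : Type u} [CommRing R] [CommRing R'] (φ : R →+* R') {n : ℕ} {c : Fin (n + 1) → R}
  {c' : Fin (n + 1) → R'} (j : Fin (n + 1)) (hpiv : c' j = φ (c j)) (hoth : ∀ i, i ≠ j → φ (c i) = φ (c j) * c' i)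
  (W' : Fin (n + 1) → ℕ)

/-- The pulled-back weight of the `c_j`-chart: `W_i = W′_i + W′_j` for `i ≠ j`, `W_j = W′_j`. [cite: CossartJannsenSaito2020, Lemma 9.2] -/
def pullbackWeightAt (j : Fin (n + 1)) (W' : Fin (n + 1) → ℕ) : Fin (n + 1) → ℕ :=
  fun i => if i = j then W' j else W' i + W' j

/-- Components of the pulled-back weight. [cite: CossartJannsenSaito2020, Lemma 9.2] -/
theorem pullbackWeightAt_self (j : Fin (n + 1)) (W' : Fin (n + 1) → ℕ) : pullbackWeightAt j W' j = W' j := by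
  simp [pullbackWeightAt]

/-- Components of the pulled-back weight. [cite: CossartJannsenSaito2020, Lemma 9.2] -/
theorem pullbackWeightAt_of_ne {j i : Fin (n + 1)} (W' : Fin (n + 1) → ℕ) (h : i ≠ j) :
    pullbackWeightAt j W' i = W' i + W' j := by
  simp [pullbackWeightAt, h]

/-- The pulled-back weight of a positive weight is positive. [cite: CossartJannsenSaito2020, Lemma 9.2] -/
theorem pullbackWeightAt_pos {W' : Fin (n + 1) → ℕ} (hW' : ∀ i, 0 < W' i) (j : Fin (n + 1)) :
    ∀ i, 0 < pullbackWeightAt j W' i := by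
  intro i
  by_cases h : i = j
  · subst h; rw [pullbackWeightAt_self]; exact hW' i
  · rw [pullbackWeightAt_of_ne W' h]; exact Nat.add_pos_left (hW' i) _

/-- The exponent map of the `c_j`-chart: `e ↦ e` with the `j`-th exponent replaced by the total degree `|e|` (the monomial substitution
`c_i ↦ c_j c′_i` (`i ≠ j`), `c_j ↦ c_j`). [cite: CossartJannsenSaito2020, (12.5)] -/
def chartExpAt (j : Fin (n + 1)) (e : Fin (n + 1) →₀ ℕ) : Fin (n + 1) →₀ ℕ :=
  Finsupp.equivFunOnFinite.symm fun i => if i = j then e.degree else e i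

/-- Components of `chartExpAt`. [cite: CossartJannsenSaito2020, (12.5)] -/
theorem chartExpAt_self (e : Fin (n + 1) →₀ ℕ) : chartExpAt j e j = e.degree := by
  simp [chartExpAt]

/-- Components of `chartExpAt`. [cite: CossartJannsenSaito2020, (12.5)] -/
theorem chartExpAt_of_ne (e : Fin (n + 1) →₀ ℕ) {i : Fin (n + 1)} (h : i ≠ j) : chartExpAt j e i = e i := by
  simp [chartExpAt, h]

/-- `|e| = e_j + Σ_{i ≠ j} e_i`. [cite: CossartJannsenSaito2020, (12.5)] -/
theorem degree_eq_add_sum_erase (e : Fin (n + 1) →₀ ℕ) :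
    e.degree = e j + ∑ i ∈ Finset.univ.erase j, e i := by
  rw [Finsupp.degree_eq_weight_one]
  change Finsupp.weight (fun _ => 1) e = _
  rw [Finsupp.weight_apply, Finsupp.sum_fintype _ _ (by simp)]
  simp only [smul_eq_mul, mul_one]
  exact (Finset.add_sum_erase _ _ (Finset.mem_univ j)).symm

/-- `chartExpAt j` is injective. [cite: CossartJannsenSaito2020, (12.5)] -/
theorem chartExpAt_injective : Function.Injective (chartExpAt (n := n) j) := by
  intro e e' h
  have hne : ∀ i, i ≠ j → e i = e' i := fun i hi => by
    have := congrArg (fun m : Fin (n + 1) →₀ ℕ => m i) h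
    simpa [chartExpAt_of_ne j _ hi] using this
  have hdeg : e.degree = e'.degree := by
    have := congrArg (fun m : Fin (n + 1) →₀ ℕ => m j) h
    simpa [chartExpAt_self] using this
  ext i
  by_cases hi : i = j
  · subst hi
    rw [degree_eq_add_sum_erase i e, degree_eq_add_sum_erase i e'] at hdeg
    have hs : ∑ k ∈ Finset.univ.erase i, e k = ∑ k ∈ Finset.univ.erase i, e' k :=
      Finset.sum_congr rfl fun k hk => hne k (Finset.ne_of_mem_erase hk)
    omega
  · exact hne i hi

/-- **The chart turns the pulled-back weight into `W′`**: `⟨W′, chartExpAt j e⟩ = ⟨W, e⟩`. [cite: CossartJannsenSaito2020, Lemma 9.2] -/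
theorem weight_chartExpAt (e : Fin (n + 1) →₀ ℕ) :
    Finsupp.weight W' (chartExpAt j e) = Finsupp.weight (pullbackWeightAt j W') e := by
  rw [Finsupp.weight_apply, Finsupp.weight_apply, Finsupp.sum_fintype _ _ (by simp), Finsupp.sum_fintype _ _ (by simp)]
  simp only [smul_eq_mul]
  rw [← Finset.add_sum_erase _ _ (Finset.mem_univ j), ← Finset.add_sum_erase _ (fun i => e i * pullbackWeightAt j W' i)
    (Finset.mem_univ j), chartExpAt_self, pullbackWeightAt_self, degree_eq_add_sum_erase j e]
  have hs : ∑ i ∈ Finset.univ.erase j, chartExpAt j e i * W' i = ∑ i ∈ Finset.univ.erase j, e i * W' i :=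
    Finset.sum_congr rfl fun i hi => by rw [chartExpAt_of_ne j e (Finset.ne_of_mem_erase hi)]
  have hs' : ∑ i ∈ Finset.univ.erase j, e i * pullbackWeightAt j W' i =
      ∑ i ∈ Finset.univ.erase j, e i * W' i + (∑ i ∈ Finset.univ.erase j, e i) * W' j := by
    rw [Finset.sum_mul, ← Finset.sum_add_distrib]
    exact Finset.sum_congr rfl fun i hi => by rw [pullbackWeightAt_of_ne W' (Finset.ne_of_mem_erase hi)]; ring
  rw [hs, hs']
  ring

include hpiv hoth in
/-- **The image of a monomial: `φ(c^e) = c′^{chartExpAt j e}`.** [cite: CossartJannsenSaito2020, (12.5)] -/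
theorem map_cmonom_chartAt (e : Fin (n + 1) →₀ ℕ) : φ (cmonom c e) = cmonom c' (chartExpAt j e) := by
  rw [cmonom_eq_prod, cmonom_eq_prod, map_prod, ← Finset.mul_prod_erase _ _ (Finset.mem_univ j),
    ← Finset.mul_prod_erase _ (fun i => c' i ^ chartExpAt j e i) (Finset.mem_univ j), chartExpAt_self,
    degree_eq_add_sum_erase j e, pow_add, map_pow, ← hpiv]
  have hprod : ∏ i ∈ Finset.univ.erase j, φ (c i ^ e i) =
      c' j ^ (∑ i ∈ Finset.univ.erase j, e i) * ∏ i ∈ Finset.univ.erase j, c' i ^ chartExpAt j e i := by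
    rw [← Finset.prod_pow_eq_pow_sum, ← Finset.prod_mul_distrib]
    refine Finset.prod_congr rfl fun i hi => ?_
    have hij : i ≠ j := Finset.ne_of_mem_erase hi
    rw [map_pow, hoth i hij, ← hpiv, chartExpAt_of_ne j e hij, mul_pow]
  rw [hprod]
  ring

include hpiv hoth in
/-- **`φ(F^{W}_ρ) ⊆ F′^{W′}_ρ`.** [cite: Hironaka1967, §1] [cite: CossartJannsenSaito2020, Lemma 9.2] -/
theorem map_weightedOrderIdeal_le_chartAt (ρ : ℕ) :
    (weightedOrderIdeal c (pullbackWeightAt j W') ρ).map φ ≤ weightedOrderIdeal c' W' ρ := by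
  rw [weightedOrderIdeal, Ideal.map_span]
  refine Ideal.span_le.mpr ?_
  rintro _ ⟨_, ⟨e, he, rfl⟩, rfl⟩
  rw [SetLike.mem_coe, map_cmonom_chartAt φ j hpiv hoth]
  refine cmonom_mem_weightedOrderIdeal c' W' ?_
  rwa [weight_chartExpAt]

variable [IsRegularLocalRing R] [IsRegularLocalRing R']
  (hgen : Ideal.span (Set.range c) = maximalIdeal R)
  (hgen' : Ideal.span (Set.range c') = maximalIdeal R') (hdim' : ringKrullDim R' = n + 1)
  (hW' : ∀ i, 0 < W' i)

include hpiv hoth hgen hgen' hdim' hW' in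
/-- **Contraction** `F′^{W′}_ρ ∩ R ⊆ F^{W}_ρ` for the pulled-back weight `W`: an element of `R` whose image lies in the weighted ideal
of the chart lies in the weighted ideal of `R` (weighted quasi-regularity of `R′`).
[cite: CossartPiltant2008, proof of Lemma 4.5, p. 12] [cite: Hironaka1967, §1] -/
theorem mem_weightedOrderIdeal_of_map_mem_chartAt {ρ : ℕ} {f : R} (hf : φ f ∈ weightedOrderIdeal c' W' ρ) :
    f ∈ weightedOrderIdeal c (pullbackWeightAt j W') ρ := by
  classical
  have hWpos : ∀ i, 0 < pullbackWeightAt j W' i := pullbackWeightAt_pos hW' j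
  suffices key : ∀ σ, σ ≤ ρ → f ∈ weightedOrderIdeal c (pullbackWeightAt j W') σ from key ρ le_rfl
  intro σ
  induction σ with
  | zero =>
    intro _
    rw [weightedOrderIdeal_zero]; trivial
  | succ σ ih =>
    intro hσρ
    have hfσ := ih (by omega)
    obtain ⟨P, hP, hPf⟩ := (mem_weightedOrderIdeal_iff_exists_mvPolynomial c (pullbackWeightAt j W') σ f).mp hfσ
    set Pσ := weightedHomogeneousComponent (pullbackWeightAt j W') σ P with hPσ
    have hPσhom : Pσ.IsWeightedHomogeneous (pullbackWeightAt j W') σ :=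
      weightedHomogeneousComponent_isWeightedHomogeneous σ P
    have hrest : eval c (P - Pσ) ∈ weightedOrderIdeal c (pullbackWeightAt j W') (σ + 1) := by
      refine (mem_weightedOrderIdeal_iff_exists_mvPolynomial c (pullbackWeightAt j W') (σ + 1) _).mpr
        ⟨P - Pσ, fun m hm => ?_, rfl⟩
      rw [mem_support_iff, coeff_sub, hPσ, coeff_weightedHomogeneousComponent] at hm
      by_cases hwt : Finsupp.weight (pullbackWeightAt j W') m = σ
      · rw [if_pos hwt, sub_self] at hm; exact absurd rfl hm
      · rw [if_neg hwt, sub_zero] at hm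
        have := hP m (mem_support_iff.mpr hm)
        omega
    set Q : MvPolynomial (Fin (n + 1)) R' := ∑ m ∈ Pσ.support, monomial (chartExpAt j m) (φ (Pσ.coeff m)) with hQ
    have hQcoeff : ∀ m ∈ Pσ.support, Q.coeff (chartExpAt j m) = φ (Pσ.coeff m) := by
      intro m hm
      rw [hQ, coeff_sum, Finset.sum_eq_single m]
      · rw [coeff_monomial, if_pos rfl]
      · intro m' _ hne
        rw [coeff_monomial, if_neg]
        exact fun h' => hne (chartExpAt_injective j h')
      · intro hm'; exact absurd hm hm'
    have hQsupp : ∀ m ∈ Q.support, Finsupp.weight W' m = σ := by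
      intro m hm
      rw [hQ] at hm
      obtain ⟨m₀, hm₀, hmm⟩ := Finset.mem_biUnion.mp (support_sum hm)
      have hmm' := Finset.mem_singleton.mp (support_monomial_subset hmm)
      subst hmm'
      rw [weight_chartExpAt]
      exact hPσhom (mem_support_iff.mp hm₀)
    have hQeval : eval c' Q = φ (eval c Pσ) := by
      conv_rhs => rw [Pσ.as_sum, map_sum, map_sum]
      rw [hQ, map_sum]
      refine Finset.sum_congr rfl fun m _ => ?_
      rw [eval_monomial_eq_cmonom, eval_monomial_eq_cmonom, map_mul, map_cmonom_chartAt φ j hpiv hoth]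
    have hQmem : eval c' Q ∈ weightedOrderIdeal c' W' (σ + 1) := by
      rw [hQeval]
      have h1 : φ f ∈ weightedOrderIdeal c' W' (σ + 1) := weightedOrderIdeal_antitone _ _ hσρ hf
      have h2 : φ (eval c (P - Pσ)) ∈ weightedOrderIdeal c' W' (σ + 1) :=
        map_weightedOrderIdeal_le_chartAt φ j hpiv hoth W' (σ + 1) (Ideal.mem_map_of_mem _ hrest)
      have : eval c Pσ = f - eval c (P - Pσ) := by rw [map_sub, hPf]; ring
      rw [this, map_sub]
      exact Ideal.sub_mem _ h1 h2
    have hcoeff : ∀ m, Pσ.coeff m ∈ maximalIdeal R := by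
      intro m
      by_cases hm : m ∈ Pσ.support
      swap
      · rw [notMem_support_iff.mp hm]; exact Ideal.zero_mem _
      have hc := coeff_mem_maximalIdeal_of_weval_mem_weightedOrderIdeal c' hgen' hdim' W' hW' hQsupp hQmem (chartExpAt j m)
      rw [hQcoeff m hm] at hc
      by_contra hcm
      have hunit : IsUnit (Pσ.coeff m) := by
        by_contra h'; exact hcm ((IsLocalRing.mem_maximalIdeal _).mpr h')
      exact (IsLocalRing.mem_maximalIdeal _).mp hc (hunit.map φ)
    have hPσmem : eval c Pσ ∈ weightedOrderIdeal c (pullbackWeightAt j W') (σ + 1) := by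
      rw [Pσ.as_sum, map_sum]
      refine Ideal.sum_mem _ fun m hm => ?_
      rw [eval_monomial_eq_cmonom]
      have hmono : cmonom c m ∈ weightedOrderIdeal c (pullbackWeightAt j W') σ :=
        cmonom_mem_weightedOrderIdeal c _ (hPσhom (mem_support_iff.mp hm)).ge
      exact maximalIdeal_mul_weightedOrderIdeal_le c (pullbackWeightAt j W') hWpos hgen σ
        (Ideal.mul_mem_mul (hcoeff m) hmono)
    have : f = eval c Pσ + eval c (P - Pσ) := by rw [map_sub, hPf]; ring
    rw [this]
    exact Ideal.add_mem _ hPσmem hrest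

include hpiv hoth hgen hgen' hdim' hW' in
/-- **The weighted-order law under the blowing up, any dimension / pivot**: if `J ⊆ 𝔪^μ` and the weak transform `(J R′ : (φ c_j)^μ)` lies
in `F′^{W′}_{ρ′}`, then `J ⊆ F^{W}_{ρ′ + μ W′_j}` for the pulled-back weight `W` (`(φ c_j)^μ` has `W′`-weight `μ W′_j`).
[cite: CossartPiltant2008, proof of Lemma 4.5, p. 12] [cite: CossartJannsenSaito2020, Lemma 12.1 (3)] -/
theorem le_weightedOrderIdeal_of_weakTransform_le_chartAt {J : Ideal R} {μ ρ' : ℕ} (hJμ : J ≤ maximalIdeal R ^ μ)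
    (hJ' : ∀ g : R', φ (c j) ^ μ * g ∈ J.map φ → g ∈ weightedOrderIdeal c' W' ρ') :
    J ≤ weightedOrderIdeal c (pullbackWeightAt j W') (ρ' + μ * W' j) := by
  intro f hf
  refine mem_weightedOrderIdeal_of_map_mem_chartAt φ j hpiv hoth W' hgen hgen' hdim' hW' ?_
  -- `φ(𝔪^μ) ⊆ ((φ c_j)^μ)`, so `φ f = (φ c_j)^μ g`
  have hφm : (maximalIdeal R).map φ ≤ Ideal.span {φ (c j)} := by
    rw [← hgen, Ideal.map_span, Ideal.span_le]
    rintro _ ⟨_, ⟨i, rfl⟩, rfl⟩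
    by_cases hi : i = j
    · subst hi; exact Ideal.subset_span rfl
    · rw [hoth i hi]
      exact Ideal.mul_mem_right _ _ (Ideal.subset_span rfl)
  have hφf : φ f ∈ Ideal.span {φ (c j) ^ μ} := by
    rw [← Ideal.span_singleton_pow]
    have : φ f ∈ (maximalIdeal R ^ μ).map φ := Ideal.mem_map_of_mem _ (hJμ hf)
    rw [Ideal.map_pow] at this
    exact Ideal.pow_right_mono hφm μ this
  obtain ⟨g, hg⟩ := Ideal.mem_span_singleton'.mp hφf
  rw [mul_comm] at hg
  have hg' : g ∈ weightedOrderIdeal c' W' ρ' := hJ' g (hg ▸ Ideal.mem_map_of_mem _ hf)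
  rw [← hg, add_comm ρ']
  refine weightedOrderIdeal_mul_le c' W' (μ * W' j) ρ' (Ideal.mul_mem_mul ?_ hg')
  rw [← hpiv, ← cmonom_single_pow c' j μ]
  refine cmonom_mem_weightedOrderIdeal c' W' ?_
  rw [Finsupp.weight_apply, Finsupp.sum_single_index (by simp), smul_eq_mul]

end Chart

end WeightedOrder

end Literature.AlgebraicGeometry.Resolution

end
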